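import Literature.Topology.FourManifolds.CircleFramingWalk
import Literature.Topology.FourManifolds.TubeFromFraming
import Mathlib.Geometry.Manifold.PartitionOfUnity
import Mathlib.Geometry.Manifold.Algebra.Monoid
import Mathlib.LinearAlgebra.Dimension.RankNullity
import HarnessLib

/-!
# Normal framings along maps into oriented 3-manifolds by averaging positively oriented vectors

Topic `Literature/Topology/FourManifolds`; infrastructure for the named fact
`Literature.Geometry.Symplectic.exists_handleAttachingMap_of_isKnotFraming` (`TwoHandleIsotopy.lean`:
every framed knot in the boundary of a compact orientable 4-manifold is the attaching circle of
a 2-handle attaching map), whose proof needs a *smooth* normal framing of a circle in the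
orientable 3-manifold `∂W` adapted to a prescribed, merely *continuous*, normal vector field.
Everything here is proved; no named facts are introduced.

Let `X` be an oriented `C^∞` 3-manifold (charted on `ℝ³`, orientation `o`,
`Literature.Topology.FourManifolds.SmoothOrientation`), `c : M → X` a `C^∞` map from a compact
manifold and `T, A : M → ℝ³` vector fields along `c` (`T x, A x ∈ T_{c x} X = ℝ³`, read in the
preferred chart at `c x`), continuous along `c` (`ContVecAlong`: continuous when re-read in any
fixed chart, i.e. continuous into the tangent bundle, `contVecAlong_of_continuous`) and pointwise
linearly independent.  Then (`exists_smoothVecAlong_odet_pos`) **there is a vector field `B`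
along `c`, smooth along `c` (`SmoothVecAlong`), such that `(T x, A x, B x)` is a positively
oriented frame of `T_{c x} X` for every `x`** (`odet o ω₀ (c x) (T x) (A x) (B x) > 0`: the
determinant of the triple, corrected by the orientation character of the chart at `c x`).  The
proof is the partition-of-unity averaging of locally constant candidates: positivity of the
oriented determinant is an intrinsic condition (`eventually_odet_pos_iff`: it can be computed in
any fixed nearby chart, the orientation being coherent), it is *open*, and it is *convex in the
last vector* (the determinant is linear in each slot), so chart-wise constant positively
oriented third vectors, glued by a smooth partition of unity on `M`, stay positively oriented
(Hirsch, *Differential Topology* (1976), Ch. 4 §4, Thm. 4.1 ff.: an oriented `k`-plane bundle with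
`k - 1` independent sections is trivial; here written for the normal 2-plane bundle of a circle in
an oriented 3-manifold, Kosinski, *Differential Manifolds* (1993), VI.6 before Cor. 6.6, *"the only
orientable disc bundle over the circle is the product bundle"*).  Applied twice — first to
`(T, A₀)` with the orientation `o`, then to `(T, B)` with the opposite orientation — it turns a
continuous field `A₀` independent from `T` into a **smooth frame `(A, B)` of a complement of `T`
with both `(T, A, B)` and `(T, A₀, B)` positively oriented** (`exists_smooth_frame_pos`), so that
`A₀` and `A` lie on the same side of the plane `⟨T, B⟩`: the straight segment from `A₀` to `A`
never meets the line `ℝ T` (`det3_convexComb_pos`).  Packaged as linear maps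
`pairMap (A x) (B x) : ℝ² →L ℝ³` the frame is smooth along `c` in the sense of
`Literature.Topology.FourManifolds.IsSmoothAlong` (`TubeFromFraming.lean`), the input of the
tree's tube constructions (`isSmoothAlong_pairMap`, `bijective_coprod_pairMap`).

## Contents

* `det3`, its multilinearity, `det3_map` (`det3 (gT) (gA) (gB) = det g · det3 T A B`, Mathlib's
  `Module.Basis.det_comp`), independence criteria;
* `ContVecAlong`, `SmoothVecAlong` (vector fields along a map, read in charts),
  `contVecAlong_of_continuous` (from continuity into the tangent bundle),
  `contMDiffOn_tangentCoordChange_along`;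
* `osgn`, `odet`, `eventually_odet_pos_iff` (chart invariance of oriented positivity);
* `exists_smoothVecAlong_odet_pos`, `exists_smoothVecAlong_odet_pos_mid`,
  `exists_smooth_frame_pos`; `pairMap`, `isSmoothAlong_pairMap`, `bijective_coprod_pairMap`.

## References

* M. W. Hirsch, *Differential Topology*, GTM 33 (1976), Ch. 4 §4 (orientations of vector
  bundles; Thm. 4.1, Exercise 2). [HirschDT1976]
* A. A. Kosinski, *Differential Manifolds* (1993), VI.6, before Cor. 6.6. [Kosinski1993]
-/

open scoped Manifold ContDiff Topology
open Set Function Filter Module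

noncomputable section

namespace Literature.Topology.FourManifolds

/-- Local notation: `𝔼 n` is the model Euclidean space `EuclideanSpace ℝ (Fin n)`. -/
local notation "𝔼 " n:arg => EuclideanSpace ℝ (Fin n)

/-! ### The determinant of three vectors of `ℝ³` -/

section Det3

/-- The determinant of the `3 × 3` matrix with columns `T`, `A`, `B` (expanded along the first
coordinate). [folklore] -/
def det3 (T A B : 𝔼 3) : ℝ :=
  T 0 * (A 1 * B 2 - A 2 * B 1) - T 1 * (A 0 * B 2 - A 2 * B 0) + T 2 * (A 0 * B 1 - A 1 * B 0)

/-- `det3` is the determinant form of the standard basis of `ℝ³`. [folklore] -/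
theorem basisFun_det_eq_det3 (T A B : 𝔼 3) :
    (EuclideanSpace.basisFun (Fin 3) ℝ).toBasis.det ![T, A, B] = det3 T A B := by
  rw [Module.Basis.det_apply, Matrix.det_fin_three]
  simp only [Module.Basis.toMatrix_apply, OrthonormalBasis.coe_toBasis_repr_apply,
    EuclideanSpace.basisFun_repr, Matrix.cons_val_zero, Matrix.cons_val_one,
    Matrix.cons_val]
  unfold det3
  ring

/-- `det3` is additive in the last vector. [folklore] -/
theorem det3_add_right (T A B B' : 𝔼 3) : det3 T A (B + B') = det3 T A B + det3 T A B' := by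
  simp only [det3, PiLp.add_apply]; ring

/-- `det3` is homogeneous in the last vector. [folklore] -/
theorem det3_smul_right (T A B : 𝔼 3) (r : ℝ) : det3 T A (r • B) = r * det3 T A B := by
  simp only [det3, PiLp.smul_apply, smul_eq_mul]; ring

/-- `det3` is additive in the middle vector. [folklore] -/
theorem det3_add_mid (T A A' B : 𝔼 3) : det3 T (A + A') B = det3 T A B + det3 T A' B := by
  simp only [det3, PiLp.add_apply]; ring

/-- `det3` is homogeneous in the middle vector. [folklore] -/
theorem det3_smul_mid (T A B : 𝔼 3) (r : ℝ) : det3 T (r • A) B = r * det3 T A B := by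
  simp only [det3, PiLp.smul_apply, smul_eq_mul]; ring

/-- `det3` of a negated last vector. [folklore] -/
theorem det3_neg_right (T A B : 𝔼 3) : det3 T A (-B) = -det3 T A B := by
  rw [← neg_one_smul ℝ B, det3_smul_right, neg_one_mul]

/-- Swapping the last two vectors changes the sign. [folklore] -/
theorem det3_swap (T A B : 𝔼 3) : det3 T B A = -det3 T A B := by
  simp only [det3]; ring

/-- Cyclic invariance. [folklore] -/
theorem det3_cyclic (T A B : 𝔼 3) : det3 B T A = det3 T A B := by
  simp only [det3]; ring

/-- `det3` vanishes when the last vector is the first. [folklore] -/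
@[simp] theorem det3_self_right (T A : 𝔼 3) : det3 T A T = 0 := by
  simp only [det3]; ring

/-- `det3` vanishes when the middle vector is the first. [folklore] -/
@[simp] theorem det3_self_mid (T B : 𝔼 3) : det3 T T B = 0 := by
  simp only [det3]; ring

/-- `det3` is linear in the last vector: finite sums. [folklore] -/
theorem det3_sum_right {ι : Type*} (s : Finset ι) (T A : 𝔼 3) (r : ι → ℝ) (B : ι → 𝔼 3) :
    det3 T A (∑ i ∈ s, r i • B i) = ∑ i ∈ s, r i * det3 T A (B i) := by
  classical
  induction s using Finset.induction_on with
  | empty => simp [det3]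
  | insert i s hi ih => rw [Finset.sum_insert hi, Finset.sum_insert hi, det3_add_right,
      det3_smul_right, ih]

/-- A convex combination in the middle slot of two triples with positive (signed) determinant
has positive (signed) determinant. [folklore] -/
theorem det3_convexComb_pos {ε : ℝ} {T A A' B : 𝔼 3} (hA : 0 < ε * det3 T A B)
    (hA' : 0 < ε * det3 T A' B) {s : ℝ} (hs : s ∈ Icc (0 : ℝ) 1) :
    0 < ε * det3 T ((1 - s) • A + s • A') B := by
  rw [det3_add_mid, det3_smul_mid, det3_smul_mid]
  have h : ε * ((1 - s) * det3 T A B + s * det3 T A' B) =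
      (1 - s) * (ε * det3 T A B) + s * (ε * det3 T A' B) := by ring
  rw [h]
  rcases eq_or_lt_of_le hs.1 with rfl | hs0
  · simpa using hA
  · have h1 : 0 ≤ (1 - s) * (ε * det3 T A B) := mul_nonneg (by linarith [hs.2]) hA.le
    have h2 : 0 < s * (ε * det3 T A' B) := mul_pos hs0 hA'
    linarith

/-- **Change of basis**: `det3 (g T) (g A) (g B) = det g · det3 T A B`. [folklore] -/
theorem det3_map (g : 𝔼 3 →L[ℝ] 𝔼 3) (T A B : 𝔼 3) :
    det3 (g T) (g A) (g B) = LinearMap.det (g : 𝔼 3 →ₗ[ℝ] 𝔼 3) * det3 T A B := by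
  have h : (![g T, g A, g B] : Fin 3 → 𝔼 3) = (g : 𝔼 3 →ₗ[ℝ] 𝔼 3) ∘ ![T, A, B] := by
    ext i : 1
    fin_cases i <;> rfl
  rw [← basisFun_det_eq_det3, ← basisFun_det_eq_det3, h, Module.Basis.det_comp]

/-- A triple with nonzero determinant is linearly independent. [folklore] -/
theorem linearIndependent_of_det3_ne_zero {T A B : 𝔼 3} (h : det3 T A B ≠ 0) :
    LinearIndependent ℝ ![T, A, B] := by
  have h' : IsUnit ((EuclideanSpace.basisFun (Fin 3) ℝ).toBasis.det ![T, A, B]) := by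
    rw [basisFun_det_eq_det3]
    exact isUnit_iff_ne_zero.2 h
  exact ((EuclideanSpace.basisFun (Fin 3) ℝ).toBasis.is_basis_iff_det.2 h').1

/-- Coefficients of a vanishing combination of a triple with nonzero determinant vanish.
[folklore] -/
theorem eq_zero_of_det3_ne_zero {T A B : 𝔼 3} (h : det3 T A B ≠ 0) {a b b' : ℝ}
    (h0 : a • T + b • A + b' • B = 0) : a = 0 ∧ b = 0 ∧ b' = 0 := by
  have hli := Fintype.linearIndependent_iff.1 (linearIndependent_of_det3_ne_zero h) ![a, b, b']
    (by simpa [Fin.sum_univ_three] using h0)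
  exact ⟨hli 0, hli 1, hli 2⟩

/-- A positive multiple of `T` cannot appear as the middle vector of a triple with nonzero
determinant: if `det3 T A B ≠ 0` then `A ∉ ℝ ∙ T`. [folklore] -/
theorem not_mem_span_of_det3_ne_zero {T A B : 𝔼 3} (h : det3 T A B ≠ 0) :
    A ∉ (ℝ ∙ T : Submodule ℝ (𝔼 3)) := by
  rw [Submodule.mem_span_singleton]
  rintro ⟨r, rfl⟩
  rw [det3_smul_mid, det3_self_mid, mul_zero] at h
  exact h rfl

/-- Two independent vectors of `ℝ³` can be completed to a triple with nonzero determinant.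
[folklore] -/
theorem exists_det3_ne_zero {T A : 𝔼 3} (h : LinearIndependent ℝ ![T, A]) :
    ∃ n : 𝔼 3, det3 T A n ≠ 0 := by
  obtain ⟨n, hn⟩ := exists_linearIndependent_cons_of_lt_finrank h
    (by rw [finrank_euclideanSpace_fin]; norm_num)
  have hn' : LinearIndependent ℝ ![n, T, A] := hn
  have hspan : Submodule.span ℝ (range ![n, T, A]) = ⊤ :=
    hn'.span_eq_top_of_card_eq_finrank' (by simp)
  have hu := ((EuclideanSpace.basisFun (Fin 3) ℝ).toBasis.is_basis_iff_det).1 ⟨hn', hspan⟩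
  rw [basisFun_det_eq_det3, isUnit_iff_ne_zero] at hu
  exact ⟨n, by rwa [← det3_cyclic]⟩

/-- From independence of `(T, A, B)` (nonzero determinant) the pair `(T, B)` is independent.
[folklore] -/
theorem linearIndependent_pair_of_det3_ne_zero {T A B : 𝔼 3} (h : det3 T A B ≠ 0) :
    LinearIndependent ℝ ![T, B] := by
  rw [Fintype.linearIndependent_iff]
  intro g hg i
  have hg' : g 0 • T + (0 : ℝ) • A + g 1 • B = 0 := by
    simpa [Fin.sum_univ_two] using hg
  obtain ⟨h0, -, h1⟩ := eq_zero_of_det3_ne_zero h hg'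
  fin_cases i
  · exact h0
  · exact h1

/-- `det3` is continuous in its three arguments along continuous maps (on a set). [folklore] -/
theorem continuousOn_det3 {Z : Type*} [TopologicalSpace Z] {f g h : Z → 𝔼 3} {s : Set Z}
    (hf : ContinuousOn f s) (hg : ContinuousOn g s) (hh : ContinuousOn h s) :
    ContinuousOn (fun z => det3 (f z) (g z) (h z)) s := by
  have hf' : ∀ i, ContinuousOn (fun z => f z i) s := fun i =>
    (EuclideanSpace.proj i).continuous.comp_continuousOn hf
  have hg' : ∀ i, ContinuousOn (fun z => g z i) s := fun i =>
    (EuclideanSpace.proj i).continuous.comp_continuousOn hg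
  have hh' : ∀ i, ContinuousOn (fun z => h z i) s := fun i =>
    (EuclideanSpace.proj i).continuous.comp_continuousOn hh
  unfold det3
  exact (((hf' 0).mul (((hg' 1).mul (hh' 2)).sub ((hg' 2).mul (hh' 1)))).sub
    ((hf' 1).mul (((hg' 0).mul (hh' 2)).sub ((hg' 2).mul (hh' 0))))).add
    ((hf' 2).mul (((hg' 0).mul (hh' 1)).sub ((hg' 1).mul (hh' 0))))

end Det3

/-! ### Vector fields along a map, read in charts -/

section Along

variable {EM : Type*} [NormedAddCommGroup EM] [NormedSpace ℝ EM] {HM : Type*}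
  [TopologicalSpace HM] {IM : ModelWithCorners ℝ EM HM} {M : Type*} [TopologicalSpace M]
  [ChartedSpace HM M]
  {E : Type*} [NormedAddCommGroup E] [NormedSpace ℝ E] {H : Type*} [TopologicalSpace H]

/-- **A vector field along the map `c : M → X` is continuous** (`v x ∈ T_{c x} X = E`, read in
the preferred chart at `c x`): re-read in the preferred chart at any point `p` (through the
derivative `tangentCoordChange I (c x) p (c x)` of the chart change) it is continuous on the open
set `c ⁻¹' (chart domain of p)` where this reading is meaningful — the chart form of continuity of
the section `x ↦ (c x, v x)` of `c^* TX` (`contVecAlong_of_continuous`). [folklore] -/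
def ContVecAlong (I : ModelWithCorners ℝ E H) {X : Type*} [TopologicalSpace X] [ChartedSpace H X]
    [IsManifold I 1 X] (c : M → X) (v : M → E) : Prop :=
  ∀ p : X, ContinuousOn (fun x => tangentCoordChange I (c x) p (c x) (v x))
    (c ⁻¹' (chartAt H p).source)

/-- **A vector field along the map `c : M → X` is smooth**: every chart reading is `C^∞` on
`c ⁻¹' (chart domain)` (the vector form of `Literature.Topology.FourManifolds.IsSmoothAlong`).
[folklore] -/
def SmoothVecAlong (IM : ModelWithCorners ℝ EM HM) {M : Type*} [TopologicalSpace M]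
    [ChartedSpace HM M] (I : ModelWithCorners ℝ E H) {X : Type*} [TopologicalSpace X]
    [ChartedSpace H X] [IsManifold I 1 X] (c : M → X) (v : M → E) : Prop :=
  ∀ p : X, ContMDiffOn IM 𝓘(ℝ, E) ∞ (fun x => tangentCoordChange I (c x) p (c x) (v x))
    (c ⁻¹' (chartAt H p).source)

variable {I : ModelWithCorners ℝ E H} {X : Type*} [TopologicalSpace X] [ChartedSpace H X]
  [IsManifold I 1 X]

/-- **Continuity into the tangent bundle implies continuity along the map**: if
`x ↦ (c x, v x)` is continuous into `TX`, then `v` is continuous along `c` (in the local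
trivialisation of `TX` at `p` the fibre coordinate of `(c x, v x)` is exactly the chart reading
`tangentCoordChange I (c x) p (c x) (v x)`). [folklore] -/
theorem contVecAlong_of_continuous {c : M → X} {v : M → E}
    (h : Continuous fun x => (Bundle.TotalSpace.mk' E (c x) (v x) : TangentBundle I X)) :
    ContVecAlong I c v := by
  intro p
  set e := trivializationAt E (TangentSpace I) p with he
  have h1 : ContinuousOn (fun x => e (Bundle.TotalSpace.mk' E (c x) (v x)))
      (c ⁻¹' (chartAt H p).source) := by
    refine e.continuousOn.comp h.continuousOn fun x hx => ?_
    rw [e.mem_source, he, TangentBundle.trivializationAt_baseSet]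
    exact hx
  refine (continuous_snd.comp_continuousOn h1).congr fun x _ => ?_
  simp only [comp_apply, he, TangentBundle.trivializationAt_apply, tangentCoordChange_def]
  rfl

/-- A smooth field along `c` is continuous along `c`. [folklore] -/
theorem SmoothVecAlong.contVecAlong {c : M → X} {v : M → E} (h : SmoothVecAlong IM I c v) :
    ContVecAlong I c v :=
  fun p => (h p).continuousOn

end Along

section AlongSelf

variable {EM : Type*} [NormedAddCommGroup EM] [NormedSpace ℝ EM] {HM : Type*}
  [TopologicalSpace HM] {IM : ModelWithCorners ℝ EM HM} {M : Type*} [TopologicalSpace M]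
  [ChartedSpace HM M]
  {E : Type*} [NormedAddCommGroup E] [NormedSpace ℝ E]
  {X : Type*} [TopologicalSpace X] [ChartedSpace E X] [IsManifold 𝓘(ℝ, E) ∞ X]

/-- **The derivative of the chart change `p → q` is smooth along a smooth map** (on the preimage
of the overlap of the two chart domains; manifolds charted on the model vector space).
[folklore] -/
theorem contMDiffOn_tangentCoordChange_along {c : M → X} (hc : ContMDiff IM 𝓘(ℝ, E) ∞ c)
    (p q : X) :
    ContMDiffOn IM 𝓘(ℝ, E →L[ℝ] E) ∞ (fun x => tangentCoordChange 𝓘(ℝ, E) p q (c x))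
      (c ⁻¹' ((chartAt E p).source ∩ (chartAt E q).source)) := by
  have : IsManifold 𝓘(ℝ, E) (∞ + 1) X := ‹IsManifold 𝓘(ℝ, E) ∞ X›
  have h1 := (contDiffOn_fderiv_coord_change (I := 𝓘(ℝ, E)) (n := ∞) (achart E p)
    (achart E q)).contMDiffOn
  have h2 : ContMDiffOn IM 𝓘(ℝ, E) ∞ (fun x => extChartAt 𝓘(ℝ, E) p (c x))
      (c ⁻¹' ((chartAt E p).source ∩ (chartAt E q).source)) :=
    contMDiffOn_extChartAt.comp hc.contMDiffOn fun x hx => hx.1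
  refine (h1.comp h2 fun x hx => ?_).congr fun x _ => rfl
  have hx' : c x ∈ (chartAt E p).source ∩ (chartAt E q).source := hx
  have hp' : c x ∈ (extChartAt 𝓘(ℝ, E) p).source := by rw [extChartAt_source]; exact hx'.1
  change extChartAt 𝓘(ℝ, E) p (c x) ∈
    ((extChartAt 𝓘(ℝ, E) p).symm ≫ extChartAt 𝓘(ℝ, E) q).source
  rw [PartialEquiv.trans_source, mem_inter_iff, PartialEquiv.symm_source, mem_preimage,
    (extChartAt 𝓘(ℝ, E) p).left_inv hp', extChartAt_source]
  exact ⟨(extChartAt 𝓘(ℝ, E) p).map_source hp', hx'.2⟩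

/-- **A chart-wise constant field is smooth along a smooth map**: for a fixed vector `n₀` read
in the chart at `p`, the field `x ↦ τ_{p → c x} n₀` (transported to the chart at `c x`) re-reads
in the chart at `q` as `x ↦ τ_{p → q}(c x) n₀` on `c ⁻¹' (source p ∩ source q)`, a smooth map.
[folklore] -/
theorem contMDiffOn_transport_const {c : M → X} (hc : ContMDiff IM 𝓘(ℝ, E) ∞ c) (p q : X)
    (n₀ : E) :
    ContMDiffOn IM 𝓘(ℝ, E) ∞ (fun x => tangentCoordChange 𝓘(ℝ, E) (c x) q (c x)
      (tangentCoordChange 𝓘(ℝ, E) p (c x) (c x) n₀))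
      (c ⁻¹' ((chartAt E p).source ∩ (chartAt E q).source)) := by
  refine ((contMDiffOn_tangentCoordChange_along hc p q).clm_apply
    (contMDiffOn_const (c := n₀))).congr fun x hx => ?_
  have hx' : c x ∈ (chartAt E p).source ∩ (chartAt E q).source := hx
  exact tangentCoordChange_comp ⟨⟨by rw [extChartAt_source]; exact hx'.1,
    mem_extChartAt_source (c x)⟩, by rw [extChartAt_source]; exact hx'.2⟩

end AlongSelf

/-! ### Oriented determinants along a map into an oriented 3-manifold -/

section Oriented

variable {X : Type*} [TopologicalSpace X] [ChartedSpace (𝔼 3) X] [IsManifold (𝓡 3) ∞ X]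

/-- Local notation: the derivative cocycle of the chart changes of `X`. -/
local notation "τ" => tangentCoordChange (𝓡 3)

open Classical in
/-- **The orientation character of the chart at `x`**: `+1` if the orientation `o x` of
`T_x X = ℝ³` (read in the preferred chart at `x`) is the reference orientation `ω₀`, `-1`
otherwise. [folklore] -/
def osgn (o : SmoothOrientation (𝓡 3) X) (ω₀ : Orientation ℝ (𝔼 3) (Fin (finrank ℝ (𝔼 3))))
    (x : X) : ℝ :=
  if o x = ω₀ then 1 else -1

/-- **The oriented determinant** of three tangent vectors at `x` (read in the preferred chart at
`x`): the determinant corrected by the orientation character of that chart, so that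
`0 < odet o ω₀ x T A B` means "`(T, A, B)` is a positively oriented frame of `T_x X`" for the
orientation `o` (relative to the reference `ω₀`). [folklore] -/
def odet (o : SmoothOrientation (𝓡 3) X) (ω₀ : Orientation ℝ (𝔼 3) (Fin (finrank ℝ (𝔼 3))))
    (x : X) (T A B : 𝔼 3) : ℝ :=
  osgn o ω₀ x * det3 T A B

variable (o : SmoothOrientation (𝓡 3) X) (ω₀ : Orientation ℝ (𝔼 3) (Fin (finrank ℝ (𝔼 3))))

/-- The orientation character squares to one. [folklore] -/
theorem osgn_mul_self (x : X) : osgn o ω₀ x * osgn o ω₀ x = 1 := by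
  unfold osgn; split_ifs <;> norm_num

/-- The orientation character is nonzero. [folklore] -/
theorem osgn_ne_zero (x : X) : osgn o ω₀ x ≠ 0 := by
  unfold osgn; split_ifs <;> norm_num

/-- Points with the same orientation value have the same character. [folklore] -/
theorem osgn_eq_of_eq {x y : X} (h : o x = o y) : osgn o ω₀ x = osgn o ω₀ y := by
  unfold osgn; rw [h]

/-- Points with opposite orientation values have opposite characters. [folklore] -/
theorem osgn_eq_neg_of_eq_neg {x y : X} (h : o x = -o y) : osgn o ω₀ x = -osgn o ω₀ y := by
  unfold osgn
  by_cases hy : o y = ω₀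
  · have hx : o x ≠ ω₀ := by
      rw [h, hy]
      exact (Module.Ray.ne_neg_self ω₀).symm
    rw [if_neg hx, if_pos hy]
  · have hx : o x = ω₀ := by
      rcases orientation_eq_or_eq_neg (o y) ω₀ with h1 | h1
      · exact absurd h1 hy
      · rw [h, h1]; exact neg_neg ω₀
    rw [if_pos hx, if_neg hy, neg_neg]

/-- The character of the opposite orientation is the opposite character. [folklore] -/
theorem osgn_neg (x : X) : osgn (-o) ω₀ x = -osgn o ω₀ x := by
  unfold osgn
  rw [SmoothOrientation.neg_apply]
  by_cases hx : o x = ω₀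
  · have h' : -o x ≠ ω₀ := by rw [hx]; exact (Module.Ray.ne_neg_self ω₀).symm
    rw [if_neg h', if_pos hx]
  · have h' : -o x = ω₀ := by
      rcases orientation_eq_or_eq_neg (o x) ω₀ with h1 | h1
      · exact absurd h1 hx
      · rw [h1]; exact neg_neg ω₀
    rw [if_pos h', if_neg hx, neg_neg]

/-- The oriented determinant for the opposite orientation, with the last two vectors swapped,
is the oriented determinant. [folklore] -/
theorem odet_neg_swap (x : X) (T A B : 𝔼 3) : odet (-o) ω₀ x T B A = odet o ω₀ x T A B := by
  unfold odet
  rw [osgn_neg, det3_swap]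
  ring

/-- Negating the last vector negates the oriented determinant. [folklore] -/
theorem odet_neg_right (x : X) (T A B : 𝔼 3) : odet o ω₀ x T A (-B) = -odet o ω₀ x T A B := by
  unfold odet; rw [det3_neg_right]; ring

/-- A positive oriented determinant is a nonzero determinant. [folklore] -/
theorem det3_ne_zero_of_odet_pos {x : X} {T A B : 𝔼 3} (h : 0 < odet o ω₀ x T A B) :
    det3 T A B ≠ 0 := by
  intro h0
  rw [odet, h0, mul_zero] at h
  exact lt_irrefl _ h

/-- The oriented determinant is linear in the last vector: finite sums. [folklore] -/
theorem odet_sum_right {ι : Type*} (s : Finset ι) (x : X) (T A : 𝔼 3) (r : ι → ℝ)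
    (B : ι → 𝔼 3) :
    odet o ω₀ x T A (∑ i ∈ s, r i • B i) = ∑ i ∈ s, r i * odet o ω₀ x T A (B i) := by
  unfold odet
  rw [det3_sum_right, Finset.mul_sum]
  exact Finset.sum_congr rfl fun i _ => by ring

variable {EM : Type*} [NormedAddCommGroup EM] [NormedSpace ℝ EM] {HM : Type*}
  [TopologicalSpace HM] {IM : ModelWithCorners ℝ EM HM} {M : Type*} [TopologicalSpace M]
  [ChartedSpace HM M]

/-- **Oriented positivity is intrinsic (computable in any fixed nearby chart).** Along a
continuous `c : M → X`, for `x` near `x₀`, a triple at `c x` is positively oriented iff its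
transport to the chart at `c x₀` has `osgn (c x₀) · det3 > 0`: the orientation is coherent under
the chart change (`SmoothOrientation.eventually_eq_iff`) and `det3` is multiplied by the
Jacobian (`det3_map`). [cite: HirschDT1976, Ch. 4 §4] -/
theorem eventually_odet_pos_iff {c : M → X} (hc : Continuous c) (x₀ : M) :
    ∀ᶠ x in 𝓝 x₀, ∀ T A B : 𝔼 3,
      (0 < odet o ω₀ (c x) T A B ↔
        0 < osgn o ω₀ (c x₀) * det3 (τ (c x) (c x₀) (c x) T) (τ (c x) (c x₀) (c x) A)
          (τ (c x) (c x₀) (c x) B)) := by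
  have h1 : ∀ᶠ x in 𝓝 x₀, (o (c x) = o (c x₀) ↔
      0 < LinearMap.det ((τ (c x) (c x₀) (c x) : 𝔼 3 →L[ℝ] 𝔼 3) : 𝔼 3 →ₗ[ℝ] 𝔼 3)) :=
    hc.continuousAt.eventually (o.eventually_eq_iff (c x₀))
  have h2 : ∀ᶠ x in 𝓝 x₀, c x ∈ (chartAt (𝔼 3) (c x₀)).source :=
    hc.continuousAt.preimage_mem_nhds ((chartAt (𝔼 3) (c x₀)).open_source.mem_nhds
      (mem_chart_source _ _))
  filter_upwards [h1, h2] with x hx hxs T A B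
  set d : ℝ := LinearMap.det ((τ (c x) (c x₀) (c x) : 𝔼 3 →L[ℝ] 𝔼 3) : 𝔼 3 →ₗ[ℝ] 𝔼 3) with hd
  have hd0 : d ≠ 0 := det_tangentCoordChange_ne_zero
    ⟨mem_extChartAt_source (c x), by rw [extChartAt_source]; exact hxs⟩
  rw [det3_map, odet]
  rcases hd0.lt_or_gt with hneg | hpos
  · -- orientation values are opposite
    have hne : o (c x) ≠ o (c x₀) := fun h => (lt_irrefl (0 : ℝ)) ((hx.1 h).trans hneg)
    have hopp : o (c x) = -o (c x₀) :=
      (orientation_eq_or_eq_neg (o (c x)) (o (c x₀))).resolve_left hne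
    rw [osgn_eq_neg_of_eq_neg o ω₀ hopp]
    constructor
    · intro h
      have : 0 < (-osgn o ω₀ (c x₀) * det3 T A B) * (-d) := mul_pos h (by linarith)
      nlinarith
    · intro h
      have : 0 < (osgn o ω₀ (c x₀) * (d * det3 T A B)) * (-d)⁻¹ :=
        mul_pos h (inv_pos.2 (by linarith))
      have hd' : (-d) * (-d)⁻¹ = 1 := mul_inv_cancel₀ (by linarith)
      nlinarith
  · have heq : o (c x) = o (c x₀) := hx.2 hpos
    rw [osgn_eq_of_eq o ω₀ heq]
    constructor
    · intro h
      have : 0 < (osgn o ω₀ (c x₀) * det3 T A B) * d := mul_pos h hpos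
      nlinarith
    · intro h
      have : 0 < (osgn o ω₀ (c x₀) * (d * det3 T A B)) * d⁻¹ := mul_pos h (inv_pos.2 hpos)
      have hd' : d * d⁻¹ = 1 := mul_inv_cancel₀ hpos.ne'
      nlinarith

/-- A pair of independent vectors at `c x` is completed by a third vector to a positively
oriented triple. [folklore] -/
theorem exists_odet_pos (x : X) {T A : 𝔼 3} (h : LinearIndependent ℝ ![T, A]) :
    ∃ n : 𝔼 3, 0 < odet o ω₀ x T A n := by
  obtain ⟨n, hn⟩ := exists_det3_ne_zero h
  have h0 : odet o ω₀ x T A n ≠ 0 := mul_ne_zero (osgn_ne_zero o ω₀ x) hn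
  rcases h0.lt_or_gt with hneg | hpos
  · exact ⟨-n, by rw [odet_neg_right]; linarith⟩
  · exact ⟨n, hpos⟩

/-! ### Averaging positively oriented third vectors -/

variable [T2Space M] [CompactSpace M] [FiniteDimensional ℝ EM] [IsManifold IM ∞ M]

/-- **A smooth positively oriented third vector.** Let `c : M → X` be a smooth map from a compact
manifold into an oriented 3-manifold and `T, A` continuous vector fields along `c`, pointwise
linearly independent. Then there is a vector field `B`, smooth along `c`, with `(T x, A x, B x)`
positively oriented at every `x`: glue, by a smooth partition of unity on `M`, chart-wise constant
third vectors which are positively oriented near the points of a finite cover (positivity is open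
and computable in a fixed chart, `eventually_odet_pos_iff`); convex combinations in the last slot
preserve positivity (`odet_sum_right`). This is the frame-completion step of "an oriented plane
bundle with a nonvanishing section is trivial" (Hirsch, *Differential Topology* (1976), Ch. 4
§4, Thm. 4.1 and Exercise 2; Kosinski (1993), VI.6 before Cor. 6.6).
[cite: HirschDT1976, Ch. 4 §4, Thm. 4.1] -/
theorem exists_smoothVecAlong_odet_pos {c : M → X} (hc : ContMDiff IM (𝓡 3) ∞ c)
    {T A : M → 𝔼 3} (hT : ContVecAlong (𝓡 3) c T) (hA : ContVecAlong (𝓡 3) c A)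
    (hTA : ∀ x, LinearIndependent ℝ ![T x, A x]) :
    ∃ B : M → 𝔼 3, SmoothVecAlong IM (𝓡 3) c B ∧ ∀ x, 0 < odet o ω₀ (c x) (T x) (A x) (B x) := by
  classical
  have hcc : Continuous c := hc.continuous
  -- positively oriented third vectors at each point, transported chart-wise constantly
  choose n hn using fun x₀ : M => exists_odet_pos o ω₀ (c x₀) (hTA x₀)
  set g : M → M → 𝔼 3 := fun x₀ x => τ (c x₀) (c x) (c x) (n x₀) with hg
  -- positivity of the candidate `g x₀` near `x₀`
  set V : M → Set M := fun x₀ => interior {x | c x ∈ (chartAt (𝔼 3) (c x₀)).source ∧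
    0 < odet o ω₀ (c x) (T x) (A x) (g x₀ x)} with hV
  have hVo : ∀ x₀, IsOpen (V x₀) := fun _ => isOpen_interior
  have hVsub : ∀ x₀, V x₀ ⊆ {x | c x ∈ (chartAt (𝔼 3) (c x₀)).source ∧
      0 < odet o ω₀ (c x) (T x) (A x) (g x₀ x)} := fun _ => interior_subset
  have hmemV : ∀ x₀, x₀ ∈ V x₀ := by
    intro x₀
    rw [hV, mem_interior_iff_mem_nhds]
    have hsrc : ∀ᶠ x in 𝓝 x₀, c x ∈ (chartAt (𝔼 3) (c x₀)).source :=
      hcc.continuousAt.preimage_mem_nhds ((chartAt (𝔼 3) (c x₀)).open_source.mem_nhds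
        (mem_chart_source _ _))
    -- in the chart at `c x₀` the candidate reads constantly `n x₀`
    have hread : ∀ x, c x ∈ (chartAt (𝔼 3) (c x₀)).source →
        τ (c x) (c x₀) (c x) (g x₀ x) = n x₀ := by
      intro x hx
      have hx' : c x ∈ (extChartAt (𝓡 3) (c x₀)).source := by rwa [extChartAt_source]
      show τ (c x) (c x₀) (c x) (τ (c x₀) (c x) (c x) (n x₀)) = n x₀
      rw [tangentCoordChange_comp ⟨⟨hx', mem_extChartAt_source (c x)⟩, hx'⟩,
        tangentCoordChange_self hx']
    -- the chart-`c x₀` expression is continuous at `x₀` and positive there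
    have hcont : ContinuousAt (fun x => osgn o ω₀ (c x₀) *
        det3 (τ (c x) (c x₀) (c x) (T x)) (τ (c x) (c x₀) (c x) (A x)) (n x₀)) x₀ := by
      have hO : IsOpen (c ⁻¹' (chartAt (𝔼 3) (c x₀)).source) :=
        (chartAt (𝔼 3) (c x₀)).open_source.preimage hcc
      have h1 : ContinuousOn (fun x => osgn o ω₀ (c x₀) *
          det3 (τ (c x) (c x₀) (c x) (T x)) (τ (c x) (c x₀) (c x) (A x)) (n x₀))
          (c ⁻¹' (chartAt (𝔼 3) (c x₀)).source) :=
        continuousOn_const.mul (continuousOn_det3 (hT (c x₀)) (hA (c x₀)) continuousOn_const)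
      exact h1.continuousAt (hO.mem_nhds (mem_chart_source _ (c x₀)))
    have hpos₀ : 0 < osgn o ω₀ (c x₀) *
        det3 (τ (c x₀) (c x₀) (c x₀) (T x₀)) (τ (c x₀) (c x₀) (c x₀) (A x₀)) (n x₀) := by
      rw [tangentCoordChange_self (mem_extChartAt_source (c x₀)),
        tangentCoordChange_self (mem_extChartAt_source (c x₀))]
      exact hn x₀
    have hev : ∀ᶠ x in 𝓝 x₀, 0 < osgn o ω₀ (c x₀) *
        det3 (τ (c x) (c x₀) (c x) (T x)) (τ (c x) (c x₀) (c x) (A x)) (n x₀) :=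
      hcont.eventually (eventually_gt_nhds hpos₀)
    filter_upwards [hsrc, hev, eventually_odet_pos_iff o ω₀ hcc x₀] with x hx hx' hiff
    refine ⟨hx, ?_⟩
    rw [hiff, hread x hx]
    exact hx'
  -- a finite subcover and a subordinate smooth partition of unity
  obtain ⟨t, ht⟩ := isCompact_univ.elim_finite_subcover V hVo fun x _ => mem_iUnion.2 ⟨x, hmemV x⟩
  obtain ⟨ρ, hρ⟩ := SmoothPartitionOfUnity.exists_isSubordinate IM isClosed_univ
    (fun i : t => V i) (fun i => hVo i) (fun x hx => by rw [iUnion_subtype]; exact ht hx)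
  -- the averaged field
  refine ⟨fun x => ∑ i : t, ρ i x • g i x, fun q => ?_, fun x => ?_⟩
  · -- smoothness along `c`, read in the chart at `q`
    have hterm : ∀ i : t, ContMDiffOn IM 𝓘(ℝ, 𝔼 3) ∞
        (fun x => ρ i x • τ (c x) q (c x) (g i x)) (c ⁻¹' (chartAt (𝔼 3) q).source) := by
      intro i x₁ hx₁
      by_cases hsupp : x₁ ∈ tsupport (ρ i)
      · -- near a point of the support: the cocycle formula, smooth
        have hi : c x₁ ∈ (chartAt (𝔼 3) (c (i : M))).source := (hVsub i (hρ i hsupp)).1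
        have hO : IsOpen (c ⁻¹' ((chartAt (𝔼 3) (c (i : M))).source ∩ (chartAt (𝔼 3) q).source)) :=
          ((chartAt (𝔼 3) (c (i : M))).open_source.inter (chartAt (𝔼 3) q).open_source).preimage hcc
        have hsm := ((ρ i).contMDiff.contMDiffOn.smul
          (contMDiffOn_transport_const hc (c (i : M)) q (n i))).contMDiffAt
          (hO.mem_nhds (show x₁ ∈ _ from ⟨hi, hx₁⟩))
        exact hsm.contMDiffWithinAt
      · -- off the support: the term vanishes near `x₁`
        have hev : (fun x => ρ i x • τ (c x) q (c x) (g i x)) =ᶠ[𝓝 x₁] fun _ => 0 := by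
          have hopen : IsOpen (tsupport (ρ i))ᶜ := (isClosed_tsupport _).isOpen_compl
          filter_upwards [hopen.mem_nhds hsupp] with x hx
          rw [image_eq_zero_of_notMem_tsupport hx, zero_smul]
        exact (contMDiffAt_const.congr_of_eventuallyEq hev).contMDiffWithinAt
    have hsum : ContMDiffOn IM 𝓘(ℝ, 𝔼 3) ∞
        (fun x => ∑ i : t, ρ i x • τ (c x) q (c x) (g i x)) (c ⁻¹' (chartAt (𝔼 3) q).source) :=
      fun x hx => ContMDiffWithinAt.sum fun i _ => hterm i x hx
    refine hsum.congr fun x _ => ?_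
    simp only [map_sum, map_smul]
  · -- positivity: a convex combination of positively oriented vectors
    rw [odet_sum_right]
    have hnonneg : ∀ i : t, 0 ≤ ρ i x * odet o ω₀ (c x) (T x) (A x) (g i x) := by
      intro i
      by_cases h0 : ρ i x = 0
      · rw [h0, zero_mul]
      · have hx : x ∈ V i := hρ i (subset_tsupport _ (Function.mem_support.2 h0))
        exact mul_nonneg (ρ.nonneg i x) (hVsub i hx).2.le
    have hsum1 : ∑ i : t, ρ i x = 1 := by
      rw [← finsum_eq_sum_of_fintype]
      exact ρ.sum_eq_one (mem_univ x)
    obtain ⟨i, -, hi⟩ : ∃ i ∈ (Finset.univ : Finset t), ρ i x ≠ 0 :=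
      Finset.exists_ne_zero_of_sum_ne_zero (by rw [hsum1]; exact one_ne_zero)
    have hx : x ∈ V i := hρ i (subset_tsupport _ (Function.mem_support.2 hi))
    have hposi : 0 < ρ i x * odet o ω₀ (c x) (T x) (A x) (g i x) :=
      mul_pos (lt_of_le_of_ne (ρ.nonneg i x) (Ne.symm hi)) (hVsub i hx).2
    exact lt_of_lt_of_le hposi (Finset.single_le_sum (fun j _ => hnonneg j) (Finset.mem_univ i))

/-- **A smooth positively oriented middle vector** (the same statement with the roles of the
last two slots exchanged, via the opposite orientation). [cite: HirschDT1976, Ch. 4 §4, Thm. 4.1] -/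
theorem exists_smoothVecAlong_odet_pos_mid {c : M → X} (hc : ContMDiff IM (𝓡 3) ∞ c)
    {T B : M → 𝔼 3} (hT : ContVecAlong (𝓡 3) c T) (hB : ContVecAlong (𝓡 3) c B)
    (hTB : ∀ x, LinearIndependent ℝ ![T x, B x]) :
    ∃ A : M → 𝔼 3, SmoothVecAlong IM (𝓡 3) c A ∧ ∀ x, 0 < odet o ω₀ (c x) (T x) (A x) (B x) := by
  obtain ⟨A, hA, hpos⟩ := exists_smoothVecAlong_odet_pos (-o) ω₀ hc hT hB hTB
  exact ⟨A, hA, fun x => by rw [← odet_neg_swap]; exact hpos x⟩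

/-- **A smooth frame adapted to a continuous normal field.** Let `c : M → X` be a smooth map from
a compact manifold into an oriented 3-manifold, `T` and `A₀` continuous vector fields along `c`,
pointwise independent (`T` the velocity of an immersed circle and `A₀` a continuous normal field,
in the application). Then there are vector fields `A`, `B`, *smooth* along `c`, such that both
`(T, A, B)` and `(T, A₀, B)` are positively oriented frames everywhere — so `(A, B)` frames a
complement of `T`, and `A₀`, `A` lie on the same side of the plane `⟨T, B⟩`. Hirsch,
*Differential Topology* (1976), Ch. 4 §4 (an oriented plane bundle over the circle with a
nonvanishing section is trivial, compatibly with the section); Kosinski (1993), VI.6.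
[cite: HirschDT1976, Ch. 4 §4, Thm. 4.1 and Exercise 2] -/
theorem exists_smooth_frame_pos {c : M → X} (hc : ContMDiff IM (𝓡 3) ∞ c) {T A₀ : M → 𝔼 3}
    (hT : ContVecAlong (𝓡 3) c T) (hA₀ : ContVecAlong (𝓡 3) c A₀)
    (hTA : ∀ x, LinearIndependent ℝ ![T x, A₀ x]) :
    ∃ A B : M → 𝔼 3, SmoothVecAlong IM (𝓡 3) c A ∧ SmoothVecAlong IM (𝓡 3) c B ∧
      (∀ x, 0 < odet o ω₀ (c x) (T x) (A x) (B x)) ∧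
        ∀ x, 0 < odet o ω₀ (c x) (T x) (A₀ x) (B x) := by
  obtain ⟨B, hB, hposB⟩ := exists_smoothVecAlong_odet_pos o ω₀ hc hT hA₀ hTA
  have hTB : ∀ x, LinearIndependent ℝ ![T x, B x] := fun x =>
    linearIndependent_pair_of_det3_ne_zero (det3_ne_zero_of_odet_pos o ω₀ (hposB x))
  obtain ⟨A, hA, hposA⟩ := exists_smoothVecAlong_odet_pos_mid o ω₀ hc hT hB.contVecAlong hTB
  exact ⟨A, B, hA, hB, hposA, hposB⟩

end Oriented

/-! ### Packaging a pair of fields as a field of linear maps `ℝ² →L ℝ³` -/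

section PairMap

/-- The linear map `ℝ² → ℝ³`, `w ↦ w₀ a + w₁ b`, with columns `a`, `b`. [folklore] -/
def pairMap (a b : 𝔼 3) : 𝔼 2 →L[ℝ] 𝔼 3 :=
  (EuclideanSpace.proj (0 : Fin 2)).smulRight a + (EuclideanSpace.proj (1 : Fin 2)).smulRight b

/-- `pairMap a b w = w 0 • a + w 1 • b`. [folklore] -/
@[simp] theorem pairMap_apply (a b : 𝔼 3) (w : 𝔼 2) : pairMap a b w = w 0 • a + w 1 • b := rfl

/-- Post-composition with a linear map acts on the columns. [folklore] -/
theorem comp_pairMap (g : 𝔼 3 →L[ℝ] 𝔼 3) (a b : 𝔼 3) : g.comp (pairMap a b) = pairMap (g a) (g b) := by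
  ext w
  simp only [ContinuousLinearMap.comp_apply, pairMap_apply, map_add, map_smul]

/-- `pairMap` is a continuous linear function of its pair of columns. [folklore] -/
def pairMapL : (𝔼 3 × 𝔼 3) →L[ℝ] (𝔼 2 →L[ℝ] 𝔼 3) :=
  (ContinuousLinearMap.smulRightL ℝ (𝔼 2) (𝔼 3) (EuclideanSpace.proj (0 : Fin 2))).comp
      (ContinuousLinearMap.fst ℝ (𝔼 3) (𝔼 3)) +
    (ContinuousLinearMap.smulRightL ℝ (𝔼 2) (𝔼 3) (EuclideanSpace.proj (1 : Fin 2))).comp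
      (ContinuousLinearMap.snd ℝ (𝔼 3) (𝔼 3))

/-- `pairMapL (a, b) = pairMap a b`. [folklore] -/
@[simp] theorem pairMapL_apply (ab : 𝔼 3 × 𝔼 3) : pairMapL ab = pairMap ab.1 ab.2 := by
  ext w
  simp [pairMapL, pairMap]

variable {EM : Type*} [NormedAddCommGroup EM] [NormedSpace ℝ EM] {HM : Type*}
  [TopologicalSpace HM] {IM : ModelWithCorners ℝ EM HM} {M : Type*} [TopologicalSpace M]
  [ChartedSpace HM M]
  {X : Type*} [TopologicalSpace X] [ChartedSpace (𝔼 3) X] [IsManifold (𝓡 3) ∞ X]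

/-- **Two smooth fields along `c` give a field of linear maps smooth along `c`**
(`Literature.Topology.FourManifolds.IsSmoothAlong`, the input of `exists_tube_of_isSmoothAlong`). [folklore] -/
theorem isSmoothAlong_pairMap {c : M → X} {A B : M → 𝔼 3} (hA : SmoothVecAlong IM (𝓡 3) c A)
    (hB : SmoothVecAlong IM (𝓡 3) c B) : IsSmoothAlong IM c fun x => pairMap (A x) (B x) := by
  intro p
  have h : ContMDiffOn IM 𝓘(ℝ, 𝔼 2 →L[ℝ] 𝔼 3) ∞ (fun x => pairMapL
      (tangentCoordChange (𝓡 3) (c x) p (c x) (A x), tangentCoordChange (𝓡 3) (c x) p (c x) (B x)))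
      (c ⁻¹' (chartAt (𝔼 3) p).source) :=
    pairMapL.contMDiff.comp_contMDiffOn ((hA p).prodMk_space (hB p))
  refine h.congr fun x _ => ?_
  rw [frameIn, comp_pairMap, pairMapL_apply]

/-- **The frame property.** If `L : ℝ¹ →L ℝ³` is injective with range the line of `T` and
`det3 T A B ≠ 0`, then `L ⊕ pairMap A B : ℝ¹ × ℝ² → ℝ³` is bijective. [folklore] -/
theorem bijective_coprod_pairMap {L : 𝔼 1 →L[ℝ] 𝔼 3} {T A B : 𝔼 3}
    (hL : ∀ a, ∃ r : ℝ, L a = r • T) (hLinj : Injective L) (hd : det3 T A B ≠ 0) :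
    Bijective (L.coprod (pairMap A B)) := by
  have hinj : Injective (L.coprod (pairMap A B)) := by
    rintro ⟨a, w⟩ ⟨a', w'⟩ h
    have h0 : L (a - a') + pairMap A B (w - w') = 0 := by
      have := h
      simp only [ContinuousLinearMap.coprod_apply] at this
      rw [map_sub, map_sub, sub_add_sub_comm, this, sub_self]
    obtain ⟨r, hr⟩ := hL (a - a')
    rw [hr, pairMap_apply, ← add_assoc] at h0
    obtain ⟨hr0, hw0, hw1⟩ := eq_zero_of_det3_ne_zero hd h0
    have ha : a = a' := by
      rw [← sub_eq_zero]
      apply hLinj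
      rw [hr, hr0, zero_smul, map_zero]
    have hw : w = w' := by
      rw [← sub_eq_zero]
      ext i
      fin_cases i
      · exact hw0
      · exact hw1
    rw [ha, hw]
  refine ⟨hinj, ?_⟩
  have hdim : finrank ℝ (𝔼 1 × 𝔼 2) = finrank ℝ (𝔼 3) := by
    simp [finrank_prod]
  exact (LinearMap.injective_iff_surjective_of_finrank_eq_finrank hdim
    (f := (L.coprod (pairMap A B) : (𝔼 1 × 𝔼 2) →ₗ[ℝ] 𝔼 3))).1 hinj

end PairMap

end Literature.Topology.FourManifolds
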